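import Literature.AnabelianGeometry.EtaleTheta.Discharge.Sec1DeltaThetaTateTwist
import Literature.AnabelianGeometry.EtaleTheta.Discharge.Sec1ThetaCompactOfYcl
import Literature.AnabelianGeometry.EtaleTheta.CyclotomeTowerOfLevels
import Literature.AnabelianGeometry.EtaleTheta.ThetaSettingOriginClauses
import Mathlib.GroupTheory.SpecificGroups.Cyclic
import HarnessLib

/-!
# [EtTh] §1 p. 12 «`Δ_Θ (≅ Ẑ(1))`» AS A GALOIS MODULE, part 2: the cyclotome identification `μ_N ≅ (l·Δ_Θ) ⊗ ℤ/Nℤ`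
# CONSTRUCTED from the Tate-module clauses — the EXISTENCE half of GAP-LEDGER row G-L2t10-1; with `CyclotomeTowerOfLevels`
# the `CyclotomeTower` DATUM is a THEOREM at every setting satisfying the origin clauses (proof-only)

Mochizuki, *The étale theta function …*, Publ. RIMS **45** (2009) [EtTh], §1 PRIMS PDF pp. 12–13 «`(Ẑ(1) ≅) Δ_Θ`»,
«`(Δ^tp_Y)^ell ≅ Ẑ(1)`», «`Δ^tp_Y/Δ^tp_{Y_N} ≅ ℤ/Nℤ(1)`» [cite: MochizukiEtTh2009, §1 p.12]; §2 p. 46 «the natural isomorphism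
`μ_N ≅ (l·Δ_Θ) ⊗ (ℤ/Nℤ)`» [cite: MochizukiEtTh2009, Def 2.13 p.46]; Cor. 2.19 (ii) p. 64 (towers over cofinal chains)
[cite: MochizukiEtTh2009, Cor 2.19 (ii) p.64].  Layer L2 of the abc-iut cell, seat abc-iut-w5-d187 (gen 3); sequel of
`Sec1DeltaThetaTateTwist.lean` (the twist formula and the structure of `Δ_Θ` mod `N`).  PROOF-ONLY: no definition, no
instance, no new named fact; nothing of another seat's file is edited or restated.

WHAT IS PROVED, for `D : ThetaSetting p`:
* `nonempty_cyclotomeMod_of_tateClauses` — **CONSTRUCTION of `ThetaSetting.CyclotomeMod l N`** (abc-iut-L2-t8: a continuous,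
  `G_K`-equivariant surjection `(l·Δ_Θ) ↠ μ_N` with kernel the `N`-th powers — the DATUM of GAP-LEDGER row G-L2t10-1 at level `N`)
  from: the freeness guard `IsEtThOrigin` (F-2498), the closedness binder `hYcl` (G-w4d021-2), compactness of `Δ_Θ` + Hausdorffness
  of `(Π^tp_X)^Θ` (only for CONTINUITY; both follow from `hYcl` + R3 + the §6 bundle, abc-iut-w5-d111), `l ≠ 0`, and the level-`N`
  clauses (a) (cyclicity of `(Δ^tp_Y)^ell/N` with generator `ȳ₁`, exact order) and (b) (Tate twist on `(Δ^tp_Y)^ell`) of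
  abc-iut-w5-d051's `IsTateOrigin`.  Proof: `Δ_Θ/Δ_Θ^N` is cyclic of order `N` generated by `c₀ = θ[z,y₁]`
  (`exists_eq_pow_mul_commutator_pow`, `dvd_of_commutator_pow_eq_pow`), hence `≅ μ_N` (Mathlib `mulEquivOfCyclicCardEq`);
  `Π^tp_X`-equivariance is checked on the generator by the twist formula `σ̄ c₀ σ̄⁻¹ = e^N c₀^{χ(σ)}`
  (`exists_conj_commutator_eq_pow_mul_pow`) and `g ξ = ξ^k` on all of `μ_N` once `g ζ = ζ^k`; the identification is transported
  to `l·Δ_Θ` along the `l`-th-root isomorphism (torsion-freeness, abc-iut-L2-t8); the kernel `(l·Δ_Θ)^N` is a closed (compact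
  image) subgroup of finite index, hence OPEN, hence the surjection is continuous.  The Kummer clause (c) is not used;
* `nonempty_cyclotomeMod_of_isTateOrigin` (+ `…_of_isQuotientMap`, `…_of_origins`) — `Nonempty (D.CyclotomeMod l N)` for EVERY
  `N` and `l ≠ 0` at a setting satisfying `IsEtThOrigin`, `IsTateOrigin`, `hYcl` and (Δ_Θ compact, `(Π^tp_X)^Θ` T2) resp.
  (tempered first-countable + R3) resp. (`IsThm16Origin` + §6 `GroupLevelData`);
* `nonempty_cyclotomeTower_of_isTateOrigin` / `…_of_origins` — with this seat's `CyclotomeTowerOfLevels` (Kőnig: coherence is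
  free): **`Nonempty (D.CyclotomeTower l E)` for every cofinal chain `E ∋ 1`** — the DATUM of G-L2t10-1 (binder `τ`/`mods` of every
  [EtTh]-§2-at-the-model theorem and of the L6 chains of [IUTchII] Prop. 1.5 / Cor. 1.12 / Prop. 2.2 (ii) / Prop. 3.1 (ii)) is a
  THEOREM modulo {`IsEtThOrigin`, `IsThm16Origin` (R3), `IsTateOrigin` ((a),(b)), `hYcl` (G-w4d021-2), §6 `GroupLevelData`};
* `nonempty_cyclotomeMod_two_of_isThm16Origin` — at level `N = 2` the clause (TM₂) of `IsThm16Origin` itself suffices.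
CONSEQUENCE for the root-clause bookkeeping (L2-lead's R78 sizing; numbers, not opinions): the Tate twist of `Δ_Θ` needs NO root
field of its own — it follows from the Tate-module clauses on `(Δ^tp_Y)^ell` (which a genuine model carries for [EtTh] Thm. 1.6
anyway) plus `hYcl` + R3.  HONEST FRAMING: [EtTh] is refereed; the theta setting is data quoting print and is not asserted to exist
(the origin predicates are hypotheses, inhabited only at models); OUR kernel check that the printed «`Δ_Θ ≅ Ẑ(1)`» as a GALOIS
MODULE follows from the printed structure of `(Δ^tp_Y)^ell`; nothing here takes a side on [IUTchIII] Cor. 3.12; typed ≠ proved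
elsewhere.
-/

noncomputable section

namespace Literature.AnabelianGeometry.EtaleTheta

open Literature.AnabelianGeometry.SemiGraphs
open _root_.Topology

namespace ThetaSetting

variable {p : ℕ} [Fact p.Prime] (D : ThetaSetting p)

/-! ### The cyclotome identification `μ_N ≅ (l·Δ_Θ) ⊗ ℤ/Nℤ` from the Tate-module clauses -/

/-- `l·Δ_Θ` is compact when `Δ_Θ` is (continuous image under `x ↦ x^l`). [cite: MochizukiEtTh2009, §1 p.12] -/
theorem isCompact_lDeltaTheta_of_isCompact (hΔ : IsCompact (D.DeltaTheta : Set D.GtpTheta)) (l : ℕ) :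
    IsCompact (D.lDeltaTheta l : Set D.GtpTheta) := by
  have h : (D.lDeltaTheta l : Set D.GtpTheta) = (fun y : D.GtpTheta => y ^ l) '' (D.DeltaTheta : Set D.GtpTheta) := by
    ext x
    constructor
    · rintro ⟨y, hy, rfl⟩; exact ⟨y, hy, rfl⟩
    · rintro ⟨y, hy, rfl⟩; exact ⟨y, hy, rfl⟩
  rw [h]
  exact hΔ.image (continuous_id.pow l)

/-- **The Tate twist of `Δ_Θ`, level `N`** — «`(Ẑ(1) ≅) Δ_Θ`» (p. 12) as a GALOIS MODULE, in the cell's form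
`ThetaSetting.CyclotomeMod l N` (a continuous, `G_K`-equivariant surjection `(l·Δ_Θ) ↠ μ_N` with kernel the `N`-th
powers; the DATUM of GAP-LEDGER row G-L2t10-1 at level `N`), CONSTRUCTED from: the freeness guard `IsEtThOrigin`, the
closedness binder `hYcl` (G-w4d021-2), compactness of `Δ_Θ` and the Hausdorff property of `(Π^tp_X)^Θ` (which follow
from `hYcl` + R3 + the §6 bundle, abc-iut-w5-d111), `l ≠ 0`, and the level-`N` TATE-MODULE CLAUSES on `(Δ^tp_Y)^ell` of
abc-iut-w5-d051's `IsTateOrigin` — (a) `(Δ^tp_Y)^ell/N` is cyclic of order `N` generated by `ȳ₁`, (b) `G_K` acts on it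
through the mod-`N` cyclotomic character (`g ȳ g⁻¹ ≡ ȳ^k` when `g ζ = ζ^k`).  The identification is
`θ[z, y₁]^{l·a} · (N-th powers) ↦ ξ^a` for a generator `ξ` of `μ_N`; equivariance is the class-two computation
`σ θ[z,y₁] σ⁻¹ ≡ θ[z,y₁]^{χ(σ)}` (`exists_conj_commutator_eq_pow_mul_pow`): the Tate twist of `Δ_Θ = ∧² Δ^ell_X` is the
Tate twist of `Δ^ell_Y` (the `Z`-direction being Galois-trivial modulo `Δ_Y`).  The Kummer clause (c) of the
Tate-module datum is not used. [cite: MochizukiEtTh2009, §1 p.12] -/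
theorem nonempty_cyclotomeMod_of_tateClauses (hO : D.IsEtThOrigin)
    (hYcl : (D.DtpY.map D.toHat.toMonoidHom).topologicalClosure ≤
      D.DtpY.map D.toHat.toMonoidHom ⊔ (⁅⁅D.DeltaHat, D.DeltaHat⁆, D.DeltaHat⁆).topologicalClosure)
    (hΔ : IsCompact (D.DeltaTheta : Set D.GtpTheta)) [T2Space D.GtpTheta] {l : ℕ} (hl : l ≠ 0)
    {N : ℕ+} {z y₁ : D.PiTemp} {ζ : PadicAlgCl p} (hz : z ∈ D.DeltaTemp)
    (hzZ : D.toZ z = Multiplicative.ofAdd 1) (hy₁ : y₁ ∈ D.DtpY) (hζ : IsPrimitiveRoot ζ (N : ℕ))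
    (hgen : ∀ y ∈ D.DtpY, ∃ k : ℕ,
      Thm16Sub.toEll D y * (Thm16Sub.toEll D y₁ ^ k)⁻¹ ∈ Thm16Sub.ellPowersY D N)
    (hord : ∀ k : ℕ, Thm16Sub.toEll D y₁ ^ k ∈ Thm16Sub.ellPowersY D N ↔ (N : ℕ) ∣ k)
    (htw : ∀ (g : D.PiTemp) (k : ℕ), D.aug g ζ = ζ ^ k → ∀ y ∈ D.DtpY,
      Thm16Sub.toEll D (g * y * g⁻¹) * (Thm16Sub.toEll D y ^ k)⁻¹ ∈ Thm16Sub.ellPowersY D N) :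
    Nonempty (D.CyclotomeMod l N) := by
  classical
  -- ### the commutative group `A := Δ_Θ`, the element `c₀ = θ[z, y₁]`, the subgroup `P` of `N`-th powers
  set c₀ : D.GtpTheta := D.toTheta (z * y₁ * z⁻¹ * y₁⁻¹) with hc₀
  have hc₀Θ : c₀ ∈ D.DeltaTheta := D.toTheta_commutator_mem_deltaTheta hz hy₁.2
  have hcommA : ∀ a b : ↥D.DeltaTheta, a * b = b * a := fun a b =>
    Subtype.ext (D.ker_thetaToEll_comm _ a.2 _ b.2)
  let P : Subgroup ↥D.DeltaTheta :=
    { carrier := {t | ∃ e : ↥D.DeltaTheta, t = e ^ (N : ℕ)}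
      one_mem' := ⟨1, (one_pow _).symm⟩
      mul_mem' := by
        rintro _ _ ⟨a, rfl⟩ ⟨b, rfl⟩
        exact ⟨a * b, ((Commute.mul_pow (hcommA a b)) (N : ℕ)).symm⟩
      inv_mem' := by
        rintro _ ⟨a, rfl⟩
        exact ⟨a⁻¹, (inv_pow a (N : ℕ)).symm⟩ }
  have hPmem : ∀ t : ↥D.DeltaTheta, t ∈ P ↔ ∃ e : ↥D.DeltaTheta, t = e ^ (N : ℕ) := fun t => Iff.rfl
  haveI hPn : P.Normal := ⟨fun t ht g => by
    obtain ⟨e, rfl⟩ := (hPmem t).mp ht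
    have hg : g * e ^ (N : ℕ) * g⁻¹ = e ^ (N : ℕ) := by
      rw [hcommA g, mul_assoc, mul_inv_cancel, mul_one]
    rw [hg]
    exact (hPmem _).mpr ⟨e, rfl⟩⟩
  let a₀ : ↥D.DeltaTheta := ⟨c₀, hc₀Θ⟩
  let q₀ : ↥D.DeltaTheta ⧸ P := QuotientGroup.mk a₀
  -- ### every element of `Δ_Θ` is `e^N c₀^k`; so `Δ_Θ/P` is generated by `q₀`
  have hdecomp : ∀ a : ↥D.DeltaTheta, ∃ e : ↥D.DeltaTheta, ∃ k : ℕ, a = e ^ (N : ℕ) * a₀ ^ k := by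
    intro a
    obtain ⟨e, he, k, hk⟩ := D.exists_eq_pow_mul_commutator_pow hO hYcl hz hzZ hy₁ hgen a.2
    exact ⟨⟨e, he⟩, k, Subtype.ext (by simpa only [Subgroup.coe_mul, SubgroupClass.coe_pow] using hk)⟩
  have hgenQ : ∀ x : ↥D.DeltaTheta ⧸ P, x ∈ Subgroup.zpowers q₀ := by
    intro x
    induction x using QuotientGroup.induction_on with
    | H a =>
      obtain ⟨e, k, hak⟩ := hdecomp a
      refine Subgroup.mem_zpowers_iff.mpr ⟨k, ?_⟩
      rw [zpow_natCast, hak, QuotientGroup.mk_mul, (QuotientGroup.eq_one_iff _).mpr ((hPmem _).mpr ⟨e, rfl⟩),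
        one_mul, QuotientGroup.mk_pow]
  haveI hcyc : IsCyclic (↥D.DeltaTheta ⧸ P) :=
    ⟨⟨q₀, fun x => Subgroup.mem_zpowers_iff.mp (hgenQ x)⟩⟩
  -- ### `q₀` has order `N`, so `|Δ_Θ/P| = N`
  have horder : orderOf q₀ = (N : ℕ) := by
    refine (orderOf_eq_iff N.pos).mpr ⟨?_, fun d hdN hd0 hq => ?_⟩
    · rw [← QuotientGroup.mk_pow, QuotientGroup.eq_one_iff]
      exact ⟨a₀, rfl⟩
    · rw [← QuotientGroup.mk_pow, QuotientGroup.eq_one_iff] at hq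
      obtain ⟨e, he⟩ := (hPmem _).mp hq
      have he' : c₀ ^ d = (e : D.GtpTheta) ^ (N : ℕ) := by
        have := congrArg Subtype.val he
        simpa only [SubgroupClass.coe_pow] using this
      have hdvd : (N : ℕ) ∣ d := D.dvd_of_commutator_pow_eq_pow hO hYcl hz hzZ hy₁ hord e.2 he'
      exact absurd (Nat.le_of_dvd hd0 hdvd) (not_le.mpr hdN)
  have hcardQ : Nat.card (↥D.DeltaTheta ⧸ P) = Nat.card (MuN p N) := by
    rw [← orderOf_eq_card_of_forall_mem_zpowers hgenQ, horder, Nat.card_eq_fintype_card, card_MuN]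
  -- ### the identification on `Δ_Θ`: `red₀ : Δ_Θ ↠ Δ_Θ/P ≅ μ_N`
  let eQ : (↥D.DeltaTheta ⧸ P) ≃* MuN p N := mulEquivOfCyclicCardEq hcardQ
  let red₀ : ↥D.DeltaTheta →* MuN p N := eQ.toMonoidHom.comp (QuotientGroup.mk' P)
  have hred₀_apply : ∀ a : ↥D.DeltaTheta, red₀ a = eQ (QuotientGroup.mk a) := fun a => rfl
  have hred₀_surj : Function.Surjective red₀ :=
    eQ.surjective.comp (QuotientGroup.mk'_surjective P)
  have hred₀_ker : ∀ a : ↥D.DeltaTheta, red₀ a = 1 ↔ ∃ e : ↥D.DeltaTheta, a = e ^ (N : ℕ) := by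
    intro a
    rw [hred₀_apply, eQ.map_eq_one_iff, QuotientGroup.eq_one_iff]
    exact hPmem a
  -- equivariance of `red₀` under conjugation by `Π^tp_X`
  have hred₀_conj : ∀ (σ : D.PiTemp) (a : ↥D.DeltaTheta),
      red₀ ⟨D.toTheta σ * a * (D.toTheta σ)⁻¹,
          (inferInstanceAs D.thetaToEll.ker.Normal : D.DeltaTheta.Normal).conj_mem _ a.2 _⟩ =
        galMuN p N (D.aug.toMonoidHom σ) (red₀ a) := by
    intro σ a
    obtain ⟨k, hk⟩ := exists_apply_eq_pow hζ (D.aug.toMonoidHom σ)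
    -- the twist of `c₀`
    obtain ⟨e₁, he₁, hconj⟩ :=
      D.exists_conj_commutator_eq_pow_mul_pow hO hz hy₁ σ (htw σ k hk y₁ hy₁)
    -- decompose `a`
    obtain ⟨e, k', hak⟩ := hdecomp a
    -- conjugation as a homomorphism: `σ (e^N c₀^k') σ⁻¹ = (σ e σ⁻¹ · e₁^{k'})^N · c₀^{k k'}`
    have h1 : (a : D.GtpTheta) = (e : D.GtpTheta) ^ (N : ℕ) * c₀ ^ k' := by
      have := congrArg Subtype.val hak
      simpa only [Subgroup.coe_mul, SubgroupClass.coe_pow] using this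
    have hval : D.toTheta σ * (a : D.GtpTheta) * (D.toTheta σ)⁻¹ =
        (D.toTheta σ * e * (D.toTheta σ)⁻¹ * e₁ ^ k') ^ (N : ℕ) * c₀ ^ (k * k') := by
      have h2 : D.toTheta σ * ((e : D.GtpTheta) ^ (N : ℕ) * c₀ ^ k') * (D.toTheta σ)⁻¹ =
          (D.toTheta σ * e * (D.toTheta σ)⁻¹) ^ (N : ℕ) * (D.toTheta σ * c₀ * (D.toTheta σ)⁻¹) ^ k' := by
        rw [← MulAut.conj_apply, map_mul, map_pow, map_pow, MulAut.conj_apply, MulAut.conj_apply]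
      have hce : Commute (D.toTheta σ * e * (D.toTheta σ)⁻¹) (e₁ ^ k') := by
        have hm : D.toTheta σ * e * (D.toTheta σ)⁻¹ ∈ D.DeltaTheta :=
          (inferInstanceAs D.thetaToEll.ker.Normal : D.DeltaTheta.Normal).conj_mem _ e.2 _
        exact D.ker_thetaToEll_comm _ hm _ (pow_mem he₁ _)
      have hce₁ : Commute (e₁ ^ (N : ℕ)) (c₀ ^ k) :=
        D.ker_thetaToEll_comm _ (pow_mem he₁ _) _ (pow_mem hc₀Θ _)
      rw [h1, h2, hconj, hce₁.mul_pow, hce.mul_pow, ← pow_mul, ← pow_mul, ← pow_mul, mul_comm k' (N : ℕ)]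
      simp only [mul_assoc]
    have hmem : D.toTheta σ * (a : D.GtpTheta) * (D.toTheta σ)⁻¹ ∈ D.DeltaTheta :=
      (inferInstanceAs D.thetaToEll.ker.Normal : D.DeltaTheta.Normal).conj_mem _ a.2 _
    have hmemX : D.toTheta σ * e * (D.toTheta σ)⁻¹ * e₁ ^ k' ∈ D.DeltaTheta :=
      mul_mem ((inferInstanceAs D.thetaToEll.ker.Normal : D.DeltaTheta.Normal).conj_mem _ e.2 _)
        (pow_mem he₁ _)
    set X : ↥D.DeltaTheta := ⟨D.toTheta σ * e * (D.toTheta σ)⁻¹ * e₁ ^ k', hmemX⟩ with hX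
    have hsub : (⟨D.toTheta σ * a * (D.toTheta σ)⁻¹, hmem⟩ : ↥D.DeltaTheta) = X ^ (N : ℕ) * a₀ ^ (k * k') :=
      Subtype.ext (by
        rw [Subgroup.coe_mk, hval, Subgroup.coe_mul, SubgroupClass.coe_pow, SubgroupClass.coe_pow, hX])
    rw [hsub, map_mul, (hred₀_ker _).mpr ⟨X, rfl⟩, one_mul, map_pow, hak, map_mul,
      (hred₀_ker _).mpr ⟨e, rfl⟩, one_mul, map_pow, map_pow, galMuN_eq_pow_of_apply_eq_pow hζ hk, ← pow_mul]
  -- ### `l`-th roots: `l·Δ_Θ → Δ_Θ`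
  have hroot : ∀ x : ↥(D.lDeltaTheta l), ∃ y : ↥D.DeltaTheta, (y : D.GtpTheta) ^ l = x := fun x => by
    obtain ⟨y, hy, hyx⟩ := x.2
    exact ⟨⟨y, hy⟩, hyx⟩
  choose rt hrt using hroot
  have hrt_unique : ∀ (x : ↥(D.lDeltaTheta l)) (y : ↥D.DeltaTheta), (y : D.GtpTheta) ^ l = x → y = rt x := by
    intro x y hy
    apply Subtype.ext
    have hc : Commute (y : D.GtpTheta) ((rt x : ↥D.DeltaTheta) : D.GtpTheta)⁻¹ :=
      D.ker_thetaToEll_comm _ y.2 _ (inv_mem (rt x).2)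
    have h1 : ((y : D.GtpTheta) * ((rt x : ↥D.DeltaTheta) : D.GtpTheta)⁻¹) ^ l = 1 := by
      rw [hc.mul_pow, inv_pow, hy, hrt, mul_inv_cancel]
    exact mul_inv_eq_one.mp (D.deltaTheta_torsionfree hO (mul_mem y.2 (inv_mem (rt x).2)) hl h1)
  let rootl : ↥(D.lDeltaTheta l) →* ↥D.DeltaTheta :=
    { toFun := rt
      map_one' := (hrt_unique 1 1 (by rw [OneMemClass.coe_one, one_pow, OneMemClass.coe_one])).symm
      map_mul' := fun a b => (hrt_unique (a * b) (rt a * rt b) (by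
        rw [Subgroup.coe_mul, (Commute.mul_pow (D.ker_thetaToEll_comm _ (rt a).2 _ (rt b).2)) l, hrt, hrt,
          Subgroup.coe_mul])).symm }
  have hrootl : ∀ x, rootl x = rt x := fun x => rfl
  -- ### the identification on `l·Δ_Θ`
  let red : ↥(D.lDeltaTheta l) →* MuN p N := red₀.comp rootl
  have hred_apply : ∀ x, red x = red₀ (rt x) := fun x => rfl
  -- kernel = the `N`-th powers of `l·Δ_Θ`
  have hred_ker : ∀ x : ↥(D.lDeltaTheta l), red x = 1 ↔ ∃ y : ↥(D.lDeltaTheta l), x = y ^ (N : ℕ) := by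
    intro x
    rw [hred_apply, hred₀_ker]
    constructor
    · rintro ⟨e, he⟩
      -- `x = (rt x)^l = e^{N l} = (e^l)^N`
      refine ⟨⟨(e : D.GtpTheta) ^ l, (e : D.GtpTheta), e.2, rfl⟩, Subtype.ext ?_⟩
      rw [SubgroupClass.coe_pow, Subgroup.coe_mk, ← hrt x, he, SubgroupClass.coe_pow, ← pow_mul, ← pow_mul,
        mul_comm]
    · rintro ⟨y, rfl⟩
      refine ⟨rt y, (hrt_unique (y ^ (N : ℕ)) (rt y ^ (N : ℕ)) ?_).symm⟩
      rw [SubgroupClass.coe_pow, SubgroupClass.coe_pow, ← pow_mul, mul_comm, pow_mul, hrt]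
  -- surjective
  have hred_surj : Function.Surjective red := by
    intro ξ
    obtain ⟨a, ha⟩ := hred₀_surj ξ
    refine ⟨⟨(a : D.GtpTheta) ^ l, (a : D.GtpTheta), a.2, rfl⟩, ?_⟩
    rw [hred_apply, ← hrt_unique _ a rfl, ha]
  -- equivariant
  have hred_conj : ∀ (σ : D.PiTemp) (x : ↥(D.lDeltaTheta l)),
      red ⟨D.toTheta σ * x * (D.toTheta σ)⁻¹, (D.lDeltaTheta_normal l).conj_mem _ x.2 _⟩ =
        galMuN p N (D.aug.toMonoidHom σ) (red x) := by
    intro σ x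
    have hmem : D.toTheta σ * ((rt x : ↥D.DeltaTheta) : D.GtpTheta) * (D.toTheta σ)⁻¹ ∈ D.DeltaTheta :=
      (inferInstanceAs D.thetaToEll.ker.Normal : D.DeltaTheta.Normal).conj_mem _ (rt x).2 _
    have hrtconj : rt ⟨D.toTheta σ * x * (D.toTheta σ)⁻¹, (D.lDeltaTheta_normal l).conj_mem _ x.2 _⟩ =
        ⟨D.toTheta σ * ((rt x : ↥D.DeltaTheta) : D.GtpTheta) * (D.toTheta σ)⁻¹, hmem⟩ :=
      (hrt_unique _ _ (by rw [Subgroup.coe_mk, Subgroup.coe_mk, ← MulAut.conj_apply, ← map_pow,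
        MulAut.conj_apply, hrt])).symm
    rw [hred_apply, hrtconj, hred₀_conj, ← hred_apply]
  -- continuous: the kernel is closed (a continuous image of the compact `l·Δ_Θ`) of finite index, hence open
  haveI : CompactSpace ↥(D.lDeltaTheta l) := isCompact_iff_compactSpace.mp (D.isCompact_lDeltaTheta_of_isCompact hΔ l)
  have hker_eq : (red.ker : Set ↥(D.lDeltaTheta l)) = Set.range (fun y : ↥(D.lDeltaTheta l) => y ^ (N : ℕ)) := by
    ext x
    rw [SetLike.mem_coe, MonoidHom.mem_ker, hred_ker]
    constructor
    · rintro ⟨y, rfl⟩; exact ⟨y, rfl⟩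
    · rintro ⟨y, rfl⟩; exact ⟨y, rfl⟩
  have hker_closed : IsClosed (red.ker : Set ↥(D.lDeltaTheta l)) := by
    rw [hker_eq]
    exact (isCompact_range (continuous_id.pow _)).isClosed
  haveI : red.ker.FiniteIndex := by
    refine ⟨?_⟩
    rw [Subgroup.index_ker]
    exact Nat.card_pos.ne'
  have hker_open : IsOpen (red.ker : Set ↥(D.lDeltaTheta l)) :=
    red.ker.isOpen_of_isClosed_of_finiteIndex hker_closed
  have hred_cont : Continuous red := by
    rw [continuous_discrete_rng]
    intro b
    by_cases hb : ∃ x₀, red x₀ = b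
    · obtain ⟨x₀, rfl⟩ := hb
      have hpre : red ⁻¹' {red x₀} = (fun y => x₀ * y) '' (red.ker : Set ↥(D.lDeltaTheta l)) := by
        ext y
        simp only [Set.mem_preimage, Set.mem_singleton_iff, Set.mem_image, SetLike.mem_coe, MonoidHom.mem_ker]
        constructor
        · intro h
          exact ⟨x₀⁻¹ * y, by rw [map_mul, map_inv, h, inv_mul_cancel], by rw [mul_inv_cancel_left]⟩
        · rintro ⟨k, hk, rfl⟩
          rw [map_mul, hk, mul_one]
      rw [hpre]
      exact (Homeomorph.mulLeft x₀).isOpenMap _ hker_open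
    · have hpre : red ⁻¹' {b} = ∅ := by
        ext y
        simp only [Set.mem_preimage, Set.mem_singleton_iff, Set.mem_empty_iff_false, iff_false]
        exact fun h => hb ⟨y, h⟩
      rw [hpre]
      exact isOpen_empty
  exact ⟨{ red := red
           red_surjective := hred_surj
           red_ker := hred_ker
           continuous_red := hred_cont
           red_conj := hred_conj }⟩

/-! ### Packagings: `IsTateOrigin`, the origin clauses, the tower -/

/-- **`Nonempty (D.CyclotomeMod l N)` at EVERY level from the all-level Tate-module predicate `IsTateOrigin`** (abc-iut-w5-d051),
under `IsEtThOrigin`, `hYcl`, `Δ_Θ` compact, `(Π^tp_X)^Θ` Hausdorff, `l ≠ 0`. [cite: MochizukiEtTh2009, §1 p.13] -/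
theorem nonempty_cyclotomeMod_of_isTateOrigin (hO : D.IsEtThOrigin) (hT : D.IsTateOrigin)
    (hYcl : (D.DtpY.map D.toHat.toMonoidHom).topologicalClosure ≤
      D.DtpY.map D.toHat.toMonoidHom ⊔ (⁅⁅D.DeltaHat, D.DeltaHat⁆, D.DeltaHat⁆).topologicalClosure)
    (hΔ : IsCompact (D.DeltaTheta : Set D.GtpTheta)) [T2Space D.GtpTheta] {l : ℕ} (hl : l ≠ 0) (N : ℕ+) :
    Nonempty (D.CyclotomeMod l N) := by
  obtain ⟨y₁, z, ζ, r, hy₁, hz, hzZ, hζ, -, hgen, hord, htw, -⟩ := hT.tate N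
  exact D.nonempty_cyclotomeMod_of_tateClauses hO hYcl hΔ hl hz hzZ hy₁ hζ hgen hord htw

/-- The same with the topological inputs SUPPLIED: `Π^tp_X` tempered first-countable + `hYcl` give `Δ_Θ` compact, and R3
(`IsQuotientMap toTheta`) gives `(Π^tp_X)^Θ` Hausdorff (abc-iut-w5-d111, `Sec1ThetaCompactOfYcl`). [cite: MochizukiEtTh2009, §1 p.13] -/
theorem nonempty_cyclotomeMod_of_isTateOrigin_of_isQuotientMap (hO : D.IsEtThOrigin) (hT : D.IsTateOrigin)
    (hYcl : (D.DtpY.map D.toHat.toMonoidHom).topologicalClosure ≤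
      D.DtpY.map D.toHat.toMonoidHom ⊔ (⁅⁅D.DeltaHat, D.DeltaHat⁆, D.DeltaHat⁆).topologicalClosure)
    (hT' : IsTempered D.PiTemp) [FirstCountableTopology D.PiTemp] (hq : IsQuotientMap D.toTheta) {l : ℕ} (hl : l ≠ 0)
    (N : ℕ+) : Nonempty (D.CyclotomeMod l N) := by
  haveI := D.t2Space_gtpTheta_of_isQuotientMap hq
  exact D.nonempty_cyclotomeMod_of_isTateOrigin hO hT hYcl (D.isCompact_deltaTheta_of_closure_map_dtpY_le hT' hYcl) hl N

/-- **The cyclotome identification at every level from the ORIGIN CLAUSES**: `IsEtThOrigin` (F-2498) + `IsThm16Origin` (its field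
R3) + `IsTateOrigin` + `hYcl` (G-w4d021-2) + the §6 parameter bundle `d : D.toTemperedCurve.GroupLevelData`, `l ≠ 0`.
[cite: MochizukiEtTh2009, §1 p.13] -/
theorem nonempty_cyclotomeMod_of_origins (hO : D.IsEtThOrigin) (h16 : D.IsThm16Origin) (hT : D.IsTateOrigin)
    (d : D.toTemperedCurve.GroupLevelData)
    (hYcl : (D.DtpY.map D.toHat.toMonoidHom).topologicalClosure ≤
      D.DtpY.map D.toHat.toMonoidHom ⊔ (⁅⁅D.DeltaHat, D.DeltaHat⁆, D.DeltaHat⁆).topologicalClosure)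
    {l : ℕ} (hl : l ≠ 0) (N : ℕ+) : Nonempty (D.CyclotomeMod l N) := by
  haveI := D.t2Space_gtpTheta_of_isQuotientMap h16.isQuotientMap_toTheta
  exact D.nonempty_cyclotomeMod_of_isTateOrigin hO hT hYcl (D.isCompact_deltaTheta_of_groupLevelData d hYcl) hl N

/-- **G-L2t10-1 as a THEOREM at origin settings: a compatible `CyclotomeTower` over EVERY cofinal chain `E ∋ 1`** — levelwise
existence (`nonempty_cyclotomeMod_of_isTateOrigin`) + coherence-is-free (`nonempty_cyclotomeTower_of_forall_nonempty`, Kőnig,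
this seat's `CyclotomeTowerOfLevels`). [cite: MochizukiEtTh2009, Cor 2.19 (ii) p.64] -/
theorem nonempty_cyclotomeTower_of_isTateOrigin (hO : D.IsEtThOrigin) (hT : D.IsTateOrigin)
    (hYcl : (D.DtpY.map D.toHat.toMonoidHom).topologicalClosure ≤
      D.DtpY.map D.toHat.toMonoidHom ⊔ (⁅⁅D.DeltaHat, D.DeltaHat⁆, D.DeltaHat⁆).topologicalClosure)
    (hΔ : IsCompact (D.DeltaTheta : Set D.GtpTheta)) [T2Space D.GtpTheta] {l : ℕ} (hl : l ≠ 0)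
    {E : Set ℕ+} (one_mem : (1 : ℕ+) ∈ E) (cofinal : ∀ n : ℕ+, ∃ M ∈ E, n ∣ M)
    (total : ∀ M ∈ E, ∀ M' ∈ E, M ∣ M' ∨ M' ∣ M) : Nonempty (D.CyclotomeTower l E) :=
  D.nonempty_cyclotomeTower_of_forall_nonempty (fun N => D.nonempty_cyclotomeMod_of_isTateOrigin hO hT hYcl hΔ hl N)
    one_mem cofinal total

/-- **The `CyclotomeTower` datum from the origin clauses** (`IsEtThOrigin`, `IsThm16Origin`, `IsTateOrigin`, `hYcl`, §6 bundle,
`l ≠ 0`), over every cofinal chain `E ∋ 1`. [cite: MochizukiEtTh2009, Cor 2.19 (ii) p.64] -/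
theorem nonempty_cyclotomeTower_of_origins (hO : D.IsEtThOrigin) (h16 : D.IsThm16Origin) (hT : D.IsTateOrigin)
    (d : D.toTemperedCurve.GroupLevelData)
    (hYcl : (D.DtpY.map D.toHat.toMonoidHom).topologicalClosure ≤
      D.DtpY.map D.toHat.toMonoidHom ⊔ (⁅⁅D.DeltaHat, D.DeltaHat⁆, D.DeltaHat⁆).topologicalClosure)
    {l : ℕ} (hl : l ≠ 0) {E : Set ℕ+} (one_mem : (1 : ℕ+) ∈ E) (cofinal : ∀ n : ℕ+, ∃ M ∈ E, n ∣ M)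
    (total : ∀ M ∈ E, ∀ M' ∈ E, M ∣ M' ∨ M' ∣ M) : Nonempty (D.CyclotomeTower l E) :=
  D.nonempty_cyclotomeTower_of_forall_nonempty (fun N => D.nonempty_cyclotomeMod_of_origins hO h16 hT d hYcl hl N)
    one_mem cofinal total

/-- At level `N = 2` the clause (TM₂) carried by `IsThm16Origin` itself suffices (with `IsEtThOrigin`, `hYcl`, the §6 bundle):
`Nonempty (D.CyclotomeMod l 2)`. [cite: MochizukiEtTh2009, §1 p.13] -/
theorem nonempty_cyclotomeMod_two_of_isThm16Origin (hO : D.IsEtThOrigin) (h16 : D.IsThm16Origin)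
    (d : D.toTemperedCurve.GroupLevelData)
    (hYcl : (D.DtpY.map D.toHat.toMonoidHom).topologicalClosure ≤
      D.DtpY.map D.toHat.toMonoidHom ⊔ (⁅⁅D.DeltaHat, D.DeltaHat⁆, D.DeltaHat⁆).topologicalClosure)
    {l : ℕ} (hl : l ≠ 0) : Nonempty (D.CyclotomeMod l 2) := by
  haveI := D.t2Space_gtpTheta_of_isQuotientMap h16.isQuotientMap_toTheta
  obtain ⟨y₁, z, ζ, r, hy₁, hz, hzZ, hζ, -, hgen, hord, htw, -⟩ := h16.tate2
  exact D.nonempty_cyclotomeMod_of_tateClauses hO hYcl (D.isCompact_deltaTheta_of_groupLevelData d hYcl) hl hz hzZ hy₁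
    hζ hgen hord htw

end ThetaSetting

end Literature.AnabelianGeometry.EtaleTheta

end
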